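import Summits.ValiantsHypothesis.ValiantsHypothesis.Theses.SymmetroidDescartes
import Summits.ValiantsHypothesis.ValiantsHypothesis.Theses.LacunarySymmetroid
import Summits.ValiantsHypothesis.ValiantsHypothesis.Theorems.LacunarySymmetroidMatrixDescartesCensusDefs
import Summits.ValiantsHypothesis.ValiantsHypothesis.Theorems.LacunarySymmetroidOneTermSector
import Summits.ValiantsHypothesis.ValiantsHypothesis.Theorems.LacunarySymmetroidTwoTermSector
import Summits.ValiantsHypothesis.ValiantsHypothesis.Theorems.LacunarySymmetroidMatrixDescartesStubNegRoots
import Summits.ValiantsHypothesis.ValiantsHypothesis.Theorems.LacunarySymmetroidMatrixDescartesStubDescartesCeiling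
import Summits.ValiantsHypothesis.ValiantsHypothesis.Theorems.MatrixDescartes.Negative.MatrixDescartesWitness24
import Summits.ValiantsHypothesis.ValiantsHypothesis.Theorems.SymmetroidDescartesDerivedPencilRolleRefutation

/-!
# `MatrixDescartes` — census frame: the crux as printed, the census currency, known rows, NO-GO record

HONEST FRAMING.  This file belongs to the object-search cell `pub-symmetroid` (census → sharp conjecture →
proof for the LAST open crux `MatrixDescartes` of route `LacunarySymmetroid`).  It proves NO new bound toward
the crux and claims nothing about `VP ≠ VNP`: it (1) reads back the crux EXACTLY as the ledger item
`stmt-ValiantsHypothesis-18050` states it, (2) fixes the census currency and shows the crux is a statement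
about that currency, (3) collects the rows of the census table that are ALREADY tree theorems, with the
certificate lemmas the census engines' extremisers will be checked against, and (4) records the refuted
sibling step `DerivedPencilRolle` as a NO-GO, by pointer to the refutation of record.  No summit claim.

(1) THE CRUX AS PRINTED.  The named `Prop` is the route declaration
`Summit.ValiantsHypothesis.ValiantsHypothesis.Theses.LacunarySymmetroid.MatrixDescartes` (route file
`Theses/LacunarySymmetroid.lean`, generated by the gate from the item; NOT re-declared here — one
declaration per notion): for all `c q : ℕ` with `0 < q` there is `K₀` such that for all `K ≥ K₀`, all
`m ≤ 2 ^ ((Nat.log 2 K + c) ^ c)`, all exponents `d : Fin K → ℕ` and all real symmetric `m × m` matrices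
`S l`, the number `Z` of distinct real zeros of `det (∑ l, X ^ (d l) • S l)` satisfies
`Z ^ q ≤ 2 ^ (K * Nat.log 2 K)`.  `matrixDescartes_def` is the kernel read-back (`Iff.rfl`) of that text.

(2) CENSUS CURRENCY.  `RealRootLawAt m K B` (companion Defs module
`LacunarySymmetroidMatrixDescartesCensusDefs`): every `K`-term real symmetric `m × m` lacunary pencil has
at most `B` distinct real zeros of its determinant (the crux's own count `(det _).roots.toFinset.card`;
the zero polynomial has no counted roots).  The census number `M(m, K)` is the least such `B`;
`matrixDescartes_iff_realRootLaw` says the crux is exactly "eventually in `K`, uniformly for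
`m ≤ 2^((log₂K+c)^c)`, some admissible `B` has `B^q ≤ 2^(K log₂ K)`", i.e. `log M(m,K) = o(K log K)` in
the quasi-polynomial regime.  The positive-zero currency `PosRootLawAt` of the disprover's file
(`MatrixDescartesWitness24`) is linked both ways (`posRootLawAt_of_realRootLawAt`,
`realRootLawAt_of_posRootLawAt`: `Z ≤ 2 Z₊-bound + 1` by the reflection `X ↦ −X`, tree `stub_negRoots`).

(3) KNOWN ROWS (all tree theorems, re-typed in the currency): `K = 1`: `M(m,1) ≤ 1` (`OneTermSector`);
`K = 2`: `M(m,2) ≤ 2m+1` (sharpening of `TwoTermSector` to arbitrary exponent order, with the root `0`);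
every `K ≥ 1`: `Z₊ ≤ C(m+K−1, m) − 1` and `Z ≤ 2·C(m+K−1, m) − 1` (sparse Descartes rule on the
`C(m+K−1,m)` count-vector monomials, tree `stub_descartesCeiling`).  The certificate lemmas for
engine-found extremisers and the first certified rows at `(m,K) = (2,4)` (`M₊(2,4) = 9` closed,
`10 ≤ M(2,4) ≤ 19`) are in the companion file `LacunarySymmetroidMatrixDescartesCensusCertificates.lean`.

(4) NO-GO RECORD — `DerivedPencilRolle` (sibling route `SymmetroidDescartes`, item
`stmt-ValiantsHypothesis-18500`, the rev-1 inductive "matrix Rolle" step with POLYNOMIAL budget):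
"`∃ C a, ∀ m K (S : Fin (K+1) → Matrix (Fin m) (Fin m) ℝ) (d : Fin (K+1) → ℕ)`, all `S l` symmetric and
invertible, `d` strictly increasing `⇒ Z₊(det F) ≤ C · Z₊(det ∂F) + (m+K)^a`", `F = ∑ X^(d l) • S l`,
`∂F = ∑_{l≥1} (d l − d 0) X^(d l − d 0 − 1) • S l` (verbatim Lean text: `derivedPencilRolle_def`).  It is
FALSE: refuted by `Summit.ValiantsHypothesis.ValiantsHypothesis.Theorems.SymmetroidDescartes.not_DerivedPencilRolle`
(file `Theorems/SymmetroidDescartesDerivedPencilRolleRefutation.lean`, tree commit `6926a673794b`,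
2026-08-17; negatives index entry for stmt-18500), via the STAIRCASE family: symmetric pencils with
`K = L+2` terms, size `m ≤ 2^(6L+12) n^6` and `n^L − 1` sign alternations on `(0, ∞)`, beating every
bound `K·C^K·(m+K)^a`.  Scope of the NO-GO for this census: it excludes every Rolle-step budget, and every
law for `Z₊`, that is polynomial in `m + K` with degree independent of `K`; its witnesses have size
exponential in `K`, so it constrains neither the crux's regime (`m` quasi-polynomial in `K`) nor laws of
Descartes shape (`m^Θ(K)`, `C(m+K−1, m)`).  The repaired sibling step is `DerivedPencilRolleQuasi`
(budget `(K+1)^(A·K) · 2^((log₂ m + 2)^A)`), open.  `derivedPencilRolle_noGo` re-exports the refutation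
so that the pointer is kernel-checked from this file.

Sources: the items and tree files named above; Descartes' rule of signs [folklore]; Cameron–Psarrakos,
Operators and Matrices 13 (2019), doi:10.7153/oam-2019-13-48 (definite pencils; its conjecture (6) is
refuted in the tree at `m = 2`, `LacunarySymmetroidMatrixDescartesDefiniteWitness`).  Deliberately NOT here:
the cell's conjectured sharp law (to be typed from `CONJECTURE.md` as a named `def … : Prop` when it
exists) and engine-generated extremisers (separate certificate files).
-/

-- `Summit.ValiantsHypothesis.ValiantsHypothesis.…` repeats a component by the D-0017 layout
-- (single-conjunct summit), which the `dupNamespace` linter flags; the name is mandated.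
set_option linter.dupNamespace false

namespace Summit.ValiantsHypothesis.ValiantsHypothesis.Theorems.LacunarySymmetroidMatrixDescartes.Census

open Summit.ValiantsHypothesis.ValiantsHypothesis.Theses.LacunarySymmetroid (MatrixDescartes)
open Summit.ValiantsHypothesis.ValiantsHypothesis.Theorems.MatrixDescartes.Negative (PosRootLawAt)
open scoped BigOperators Matrix
open Polynomial

/-! ## (1) The crux as printed -/

/-- **Read-back of the crux.**  The route declaration `MatrixDescartes` IS, by `Iff.rfl`, the text of
ledger item `stmt-ValiantsHypothesis-18050` (no strengthening, no weakening). [folklore] -/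
theorem matrixDescartes_def : MatrixDescartes ↔
    ∀ c q : ℕ, 0 < q → ∃ K₀ : ℕ, ∀ K m : ℕ, K₀ ≤ K → m ≤ 2 ^ ((Nat.log 2 K + c) ^ c) →
      ∀ (d : Fin K → ℕ) (S : Fin K → Matrix (Fin m) (Fin m) ℝ), (∀ l, (S l).IsSymm) →
        (Matrix.det (∑ l, ((Polynomial.X : Polynomial ℝ) ^ d l) • (S l).map Polynomial.C)
          ).roots.toFinset.card ^ q ≤ 2 ^ (K * Nat.log 2 K) :=
  Iff.rfl

/-! ## (2) The census currency -/

-- The row predicate `RealRootLawAt m K B` ("`M(m,K) ≤ B`") is declared in the companion Defs module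
-- `LacunarySymmetroidMatrixDescartesCensusDefs` (same namespace prefix, without `.Census`).

/-- A row with a larger bound follows from a row with a smaller one. [folklore] -/
theorem realRootLawAt_mono {m K B B' : ℕ} (hBB' : B ≤ B') (h : RealRootLawAt m K B) :
    RealRootLawAt m K B' :=
  fun d S hS => (h d S hS).trans hBB'

/-- The all-real-zeros row implies the positive-zeros row with the same bound. [folklore] -/
theorem posRootLawAt_of_realRootLawAt {m K B : ℕ} (h : RealRootLawAt m K B) : PosRootLawAt m K B :=
  fun d S hS => (Finset.card_filter_le _ _).trans (h d S hS)

/-- **Reflection transfer.**  A positive-zeros row `Z₊ ≤ B` gives the all-real-zeros row `Z ≤ 2B + 1`: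
the negative zeros of the pencil `(d, S)` are the positive zeros of the reflected pencil
`(d, (−1)^(d l) • S l)` (still symmetric), and `0` counts at most once (tree `stub_negRoots`). [folklore] -/
theorem realRootLawAt_of_posRootLawAt {m K B : ℕ} (h : PosRootLawAt m K B) :
    RealRootLawAt m K (2 * B + 1) := by
  intro d S hS
  have h1 := h d S hS
  have h2 := h d (fun l => ((-1 : ℝ) ^ d l) • S l) (fun l => (hS l).smul _)
  have h3 := stub_negRoots K m d S
  calc (Matrix.det (∑ l, ((Polynomial.X : Polynomial ℝ) ^ d l) • (S l).map Polynomial.C)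
          ).roots.toFinset.card
      ≤ _ := h3
    _ ≤ B + B + 1 := Nat.add_le_add (Nat.add_le_add h1 h2) le_rfl
    _ = 2 * B + 1 := by ring

/-- **The crux is a statement about the census currency**: `MatrixDescartes` holds iff for all `c` and
`q > 0`, eventually in `K` and uniformly for `m ≤ 2^((⌊log₂K⌋+c)^c)`, the format `(m, K)` admits a row
`RealRootLawAt m K B` with `B ^ q ≤ 2 ^ (K ⌊log₂ K⌋)` — i.e. `log M(m,K) = o(K log K)` in the
quasi-polynomial regime.  (`→`: take `B` the largest `n ≤ 2^(K⌊log₂K⌋)` with `n^q ≤ 2^(K⌊log₂K⌋)`;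
`←`: monotonicity of `n ↦ n^q`.) [folklore] -/
theorem matrixDescartes_iff_realRootLaw : MatrixDescartes ↔
    ∀ c q : ℕ, 0 < q → ∃ K₀ : ℕ, ∀ K m : ℕ, K₀ ≤ K → m ≤ 2 ^ ((Nat.log 2 K + c) ^ c) →
      ∃ B : ℕ, RealRootLawAt m K B ∧ B ^ q ≤ 2 ^ (K * Nat.log 2 K) := by
  constructor
  · intro h c q hq
    obtain ⟨K₀, hK⟩ := h c q hq
    refine ⟨K₀, fun K m hKK hm => ?_⟩
    have hP0 : (fun n : ℕ => n ^ q ≤ 2 ^ (K * Nat.log 2 K)) 0 := by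
      show 0 ^ q ≤ 2 ^ (K * Nat.log 2 K)
      rw [zero_pow hq.ne']
      exact Nat.zero_le _
    refine ⟨Nat.findGreatest (fun n : ℕ => n ^ q ≤ 2 ^ (K * Nat.log 2 K)) (2 ^ (K * Nat.log 2 K)),
      fun d S hS => ?_,
      Nat.findGreatest_spec (P := fun n : ℕ => n ^ q ≤ 2 ^ (K * Nat.log 2 K)) (Nat.zero_le _) hP0⟩
    have hZ := hK K m hKK hm d S hS
    exact Nat.le_findGreatest ((Nat.le_self_pow hq.ne' _).trans hZ) hZ
  · intro h c q hq
    obtain ⟨K₀, hK⟩ := h c q hq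
    refine ⟨K₀, fun K m hKK hm d S hS => ?_⟩
    obtain ⟨B, hB, hBq⟩ := hK K m hKK hm
    exact (Nat.pow_le_pow_left (hB d S hS) q).trans hBq

/-! ## (3) Known rows of the census table -/

/-- **Descartes ceiling, positive zeros**: for `K ≥ 1` every `K`-term `m × m` pencil (symmetric or not)
has `Z₊ ≤ C(m+K−1, m) − 1` (tree `stub_descartesCeiling`). [folklore] -/
theorem posRootLawAt_descartes (m K : ℕ) (hK : 0 < K) :
    PosRootLawAt m K (Nat.choose (m + K - 1) m - 1) := by
  intro d S _
  have h1 := stub_descartesCeiling K m hK d S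
  exact Nat.le_sub_one_of_lt h1

/-- **Descartes ceiling, all real zeros**: for `K ≥ 1` every `K`-term `m × m` pencil has
`Z ≤ 2·C(m+K−1, m) − 1` (positive zeros, the positive zeros of the reflected pencil, and `0`). [folklore] -/
theorem realRootLawAt_descartes (m K : ℕ) (hK : 0 < K) :
    RealRootLawAt m K (2 * Nat.choose (m + K - 1) m - 1) := by
  intro d S _
  have h1 := stub_descartesCeiling K m hK d S
  have h2 := stub_descartesCeiling K m hK d (fun l => ((-1 : ℝ) ^ d l) • S l)
  have h3 := stub_negRoots K m d S
  omega

/-- **Row `K = 1`**: a one-term pencil `X^e • S` has at most the real zero `0` (tree `OneTermSector`,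
`oneTermSector_proof`). [folklore] -/
theorem realRootLawAt_one (m : ℕ) : RealRootLawAt m 1 1 := by
  intro d S _
  have h := LacunarySymmetroid.oneTermSector_proof m (d 0) (S 0)
  simpa only [Fin.sum_univ_one] using h

/-- The affine-order two-term determinant `det (S₀ + X^e S₁)` has at most `2m` distinct real zeros: it is
`p (X^e)` with `deg p ≤ m` (tree `lacunarySymmetroid_det_twoTerm_eq_comp`), `e = 0` gives a constant, and
for `e ≥ 1` each fibre of `x ↦ x^e` has at most two real points (tree
`lacunarySymmetroid_card_le_two_of_pow_eq`).  This is the tree's `TwoTermSector` argument stopped one step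
before its slack `+ 1`. [folklore] -/
theorem card_roots_det_twoTerm_le (m e : ℕ) (S₀ S₁ : Matrix (Fin m) (Fin m) ℝ) :
    (Matrix.det (S₀.map Polynomial.C + ((Polynomial.X : Polynomial ℝ) ^ e) • S₁.map Polynomial.C)
      ).roots.toFinset.card ≤ 2 * m := by
  classical
  rw [lacunarySymmetroid_det_twoTerm_eq_comp]
  set p : ℝ[X] := Matrix.det ((Polynomial.X : ℝ[X]) • S₁.map Polynomial.C + S₀.map Polynomial.C)
    with hp
  have hdeg : p.natDegree ≤ m := by
    simpa only [Fintype.card_fin] using Polynomial.natDegree_det_X_add_C_le S₁ S₀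
  rcases Nat.eq_zero_or_pos e with rfl | he
  · simp only [pow_zero, Polynomial.comp_one, Polynomial.roots_C, Multiset.toFinset_zero,
      Finset.card_empty]
    exact Nat.zero_le _
  · by_cases hp0 : p = 0
    · simp only [hp0, Polynomial.zero_comp, Polynomial.roots_zero, Multiset.toFinset_zero,
        Finset.card_empty]
      exact Nat.zero_le _
    have hmaps : ∀ x ∈ (p.comp ((X : ℝ[X]) ^ e)).roots.toFinset,
        (fun y : ℝ => y ^ e) x ∈ p.roots.toFinset := by
      intro x hx
      simp only [Multiset.mem_toFinset, mem_roots', IsRoot.def, eval_comp, eval_pow, eval_X]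
        at hx ⊢
      exact ⟨hp0, hx.2⟩
    have hfib : ∀ b ∈ p.roots.toFinset,
        ((p.comp ((X : ℝ[X]) ^ e)).roots.toFinset.filter
          (fun x : ℝ => (fun y : ℝ => y ^ e) x = b)).card ≤ 2 :=
      fun b _ => lacunarySymmetroid_card_le_two_of_pow_eq he.ne' _ b
        (fun x hx => (Finset.mem_filter.1 hx).2)
    have h1 := Finset.card_le_mul_card_image_of_maps_to hmaps 2 hfib
    have h2 : p.roots.toFinset.card ≤ m :=
      (Multiset.toFinset_card_le _).trans ((Polynomial.card_roots' p).trans hdeg)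
    calc (p.comp ((X : ℝ[X]) ^ e)).roots.toFinset.card ≤ 2 * p.roots.toFinset.card := h1
      _ ≤ 2 * m := Nat.mul_le_mul_left 2 h2

/-- Two-term pencils with ordered exponents `a ≤ b`: `det (X^a A + X^b B) = X^(m a) · det (A + X^(b−a) B)`
has at most `2m + 1` distinct real zeros (`0` and the `≤ 2m` zeros of the affine-order factor). [folklore] -/
theorem card_roots_det_twoTerm_ordered_le (m a b : ℕ) (hab : a ≤ b) (A B : Matrix (Fin m) (Fin m) ℝ) :
    (Matrix.det (((Polynomial.X : Polynomial ℝ) ^ a) • A.map Polynomial.C +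
        ((Polynomial.X : Polynomial ℝ) ^ b) • B.map Polynomial.C)).roots.toFinset.card ≤ 2 * m + 1 := by
  classical
  obtain ⟨e, rfl⟩ := Nat.exists_eq_add_of_le hab
  have hfac : ((X : ℝ[X]) ^ a) • A.map C + ((X : ℝ[X]) ^ (a + e)) • B.map C
      = ((X : ℝ[X]) ^ a) • (A.map C + ((X : ℝ[X]) ^ e) • B.map C) := by
    rw [smul_add, smul_smul, ← pow_add]
  rw [hfac, Matrix.det_smul, Fintype.card_fin]
  set q : ℝ[X] := Matrix.det (A.map C + ((X : ℝ[X]) ^ e) • B.map C) with hq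
  by_cases hq0 : q = 0
  · rw [hq0, mul_zero, Polynomial.roots_zero, Multiset.toFinset_zero, Finset.card_empty]
    exact Nat.zero_le _
  have hXa : ((X : ℝ[X]) ^ a) ^ m ≠ 0 := pow_ne_zero _ (pow_ne_zero _ Polynomial.X_ne_zero)
  rw [Polynomial.roots_mul (mul_ne_zero hXa hq0), Multiset.toFinset_add]
  have h0 : (((X : ℝ[X]) ^ a) ^ m).roots.toFinset ⊆ {0} := by
    intro t ht
    rw [← pow_mul, Polynomial.roots_pow, Polynomial.roots_X, Multiset.mem_toFinset] at ht
    rw [Finset.mem_singleton]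
    exact Multiset.mem_singleton.1 (Multiset.mem_of_mem_nsmul ht)
  calc ((((X : ℝ[X]) ^ a) ^ m).roots.toFinset ∪ q.roots.toFinset).card
      ≤ (((X : ℝ[X]) ^ a) ^ m).roots.toFinset.card + q.roots.toFinset.card :=
        Finset.card_union_le _ _
    _ ≤ 1 + 2 * m :=
        Nat.add_le_add ((Finset.card_le_card h0).trans (by simp)) (card_roots_det_twoTerm_le m e A B)
    _ = 2 * m + 1 := by ring

/-- **Row `K = 2`**: every two-term `m × m` lacunary pencil (any exponents, any order) has at most `2m + 1`
distinct real zeros of its determinant.  Sharp in the census currency: `X^a • diag(−r_i) + X^(a+2) • 1`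
with `a ≥ 1` and distinct `r_i > 0` has the `2m + 1` zeros `0, ±√r_i`. [folklore] -/
theorem realRootLawAt_two (m : ℕ) : RealRootLawAt m 2 (2 * m + 1) := by
  intro d S _
  rw [Fin.sum_univ_two]
  rcases le_total (d 0) (d 1) with h01 | h10
  · exact card_roots_det_twoTerm_ordered_le m (d 0) (d 1) h01 (S 0) (S 1)
  · rw [add_comm]
    exact card_roots_det_twoTerm_ordered_le m (d 1) (d 0) h10 (S 1) (S 0)

/-! ## (4) NO-GO record: the refuted sibling step `DerivedPencilRolle` -/

/-- **Read-back of the refuted statement** `DerivedPencilRolle` (item `stmt-ValiantsHypothesis-18500`,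
route `SymmetroidDescartes`, rev-1 inductive step; record declaration kept in
`Theorems/SymmetroidDescartesRolleToDescartes.lean` after the route dropped the item): by `Iff.rfl` it is
the text below. [folklore] -/
theorem derivedPencilRolle_def :
    Summit.ValiantsHypothesis.ValiantsHypothesis.Theses.SymmetroidDescartes.DerivedPencilRolle ↔
    ∃ C a : ℕ, ∀ (m K : ℕ) (S : Fin (K + 1) → Matrix (Fin m) (Fin m) ℝ) (d : Fin (K + 1) → ℕ),
      (∀ l, (S l).IsSymm) → (∀ l, (S l).det ≠ 0) → StrictMono d →
        ((∑ l, (Polynomial.X : Polynomial ℝ) ^ d l • (S l).map Polynomial.C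
            ).det.roots.toFinset.filter (fun t => 0 < t)).card ≤
          C * ((∑ l : Fin K, (Polynomial.X : Polynomial ℝ) ^ (d l.succ - d 0 - 1) •
              (((d l.succ - d 0 : ℕ) : ℝ) • S l.succ).map Polynomial.C
                ).det.roots.toFinset.filter (fun t => 0 < t)).card + (m + K) ^ a :=
  Iff.rfl

/-- **NO-GO.**  `DerivedPencilRolle` is FALSE.  Refutation of record:
`Summit.ValiantsHypothesis.ValiantsHypothesis.Theorems.SymmetroidDescartes.not_DerivedPencilRolle`
(`Theorems/SymmetroidDescartesDerivedPencilRolleRefutation.lean`, commit `6926a673794b`, 2026-08-17; staircase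
family: `K = L+2` terms, polynomial size, `n^L − 1` alternations; negatives index, stmt-18500), re-exported
here so the pointer is kernel-checked.  Do not conjecture any Rolle-step budget polynomial in `m + K`
uniformly in `K`; the live repaired step is `Theses.SymmetroidDescartes.DerivedPencilRolleQuasi`. [folklore] -/
theorem derivedPencilRolle_noGo :
    ¬ Summit.ValiantsHypothesis.ValiantsHypothesis.Theses.SymmetroidDescartes.DerivedPencilRolle :=
  Summit.ValiantsHypothesis.ValiantsHypothesis.Theorems.SymmetroidDescartes.not_DerivedPencilRolle

end Summit.ValiantsHypothesis.ValiantsHypothesis.Theorems.LacunarySymmetroidMatrixDescartes.Census
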